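import Mathlib
import Summits.ResolutionOfSingularities.ResolutionOfSingularities.Theorems.WeightedInvariantLocalWeightedDropNCResSurfGraphCurveStep
import Summits.ResolutionOfSingularities.ResolutionOfSingularities.Theorems.WeightedInvariantLocalWeightedDropNCResSurfGraphPointClause

/-!
# `WeightedInvariant.LocalWeightedDrop`: NC-resolution settings for the TOT₂ line — GRAPH SURFACES, part 16: THE CURVE-MOVE CLAUSE
# (parts 10–13 assembled into one `MoveClause`, modulo the persistence of `e ≤ 2` along the curve move)

Crux item stmt-ResolutionOfSingularities-8899 `LocalWeightedDrop` (route `ResolutionOfSingularities/WeightedInvariant`), ENGINE skeleton v32/v33, residuals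
`stub_spaceNCRankDrop` / `stub_wildWideApexFourStartsWon` (res-L1-w43-strat-1's line `directrix-cut` v3.1, piece PL = `ApexPlaneExit`, SURFACE sub-case;
design memo `L/res-L1-w43-stub-4/g5/S-E2-SURF.md` §6–§8).  [OURS · L1 W4.3 · chain w43 · seat res-L1-w43-stub-4 gen 5; def-free on parts 13, 15 and
res-L1-w43-stub-1's S-SET; the count game is the programme's own; nothing here is a statement of any manuscript; AI-produced, gate-checked, weaker than
expert review.]

* **`curveMove_clause`** — from an admissibly decorated `(b₀, δ)` with a permissible graph surface `(a, b, ψ)` of apex dimension `≤ 2` whose off-base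
  boundary traces are divisible by `u₁` (`Γ_a ⊂ E_l`), the curve move `(Φ̂, 𝟙_{≠ b})` along `Γ_a = S ∩ E_a` satisfies the `MoveClause` for «the successor
  is admissibly decorated, and the head dropped or (same head and `SurfState`)» — PROVIDED `e ≤ 2` persists at same-head answers of this move
  (hypothesis `hpers`; it is the weighted-chart (N2) of memo §8, the one S-NEAR lemma still missing; for the point move the analogous fact is
  `apexPlane_transform_of_head_eq`).  Ingredients: `isBPermissible_partialShear`, `curveTangent_answer_of_head_eq` (the near point is the surface
  direction, live slot `a`), `inOffPlaneIdeal_curveTransform` (the successor surface `(b′, 0, curveStep)`).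
-/

set_option linter.dupNamespace false -- mandated namespace of this single-conjunct summit

noncomputable section

namespace Summit.ResolutionOfSingularities.ResolutionOfSingularities.Theorems

namespace TameFourTupleDrop

namespace GraphSurf

open MvPowerSeries Literature.AlgebraicGeometry.Resolution

variable {k : Type} [Field k] {m : ℕ}

/-- **THE CURVE-MOVE CLAUSE OF S-E2-SURF** (OURS · L1 W4.3), modulo the persistence hypothesis `hpers` (memo §8).  See the module docstring. -/
theorem curveMove_clause [Infinite k] {b₀ : MvPowerSeries (Fin (m + 1)) k} {δ : Decoration k m} (hadm : Admissible b₀ δ)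
    {a b : Fin (m + 1)} (hab : a ≠ b) {ψ : Fin (m + 1) → MvPowerSeries (Fin 2) k} (hψ : ∀ j, ¬ (j = a ∨ j = b) → constantCoeff (ψ j) = 0)
    (hE : ∀ l ∈ δ.E, ¬ (l = a ∨ l = b) → (X 0 : MvPowerSeries (Fin 2) k) ∣ ψ l)
    (hperm : InOffPlaneIdeal a b δ.c (subst (shear a b ψ) (δ.f * ∏ l ∈ δ.O, X l)))
    (htwo : (∀ u₁ u₂ u₃ : Fin (m + 1) → k,
        (∀ v, CobordantChart.initEval (fun _ : Fin (m + 1) => 1) (v + u₁) (δ).c ((δ).f * ∏ l ∈ (δ).O, X l) =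
          CobordantChart.initEval (fun _ : Fin (m + 1) => 1) v (δ).c ((δ).f * ∏ l ∈ (δ).O, X l)) →
        (∀ v, CobordantChart.initEval (fun _ : Fin (m + 1) => 1) (v + u₂) (δ).c ((δ).f * ∏ l ∈ (δ).O, X l) =
          CobordantChart.initEval (fun _ : Fin (m + 1) => 1) v (δ).c ((δ).f * ∏ l ∈ (δ).O, X l)) →
        (∀ v, CobordantChart.initEval (fun _ : Fin (m + 1) => 1) (v + u₃) (δ).c ((δ).f * ∏ l ∈ (δ).O, X l) =
          CobordantChart.initEval (fun _ : Fin (m + 1) => 1) v (δ).c ((δ).f * ∏ l ∈ (δ).O, X l)) →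
        ∃ α β γ : k, (α ≠ 0 ∨ β ≠ 0 ∨ γ ≠ 0) ∧ α • u₁ + β • u₂ + γ • u₃ = 0))
    (hpers : ∀ c' : Fin (m + 1) → k, c' a ≠ 0 → c' b = 0 → (δ.transform (shear a b (fun j => if j ∈ δ.E then 0 else ψ j)) (fun j => if j = b then 0 else 1) c' a).head = δ.head →
      ∀ b' : MvPowerSeries (Fin (m + 1)) k, Admissible b' (δ.transform (shear a b (fun j => if j ∈ δ.E then 0 else ψ j)) (fun j => if j = b then 0 else 1) c' a) →
      (∀ u₁ u₂ u₃ : Fin (m + 1) → k,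
        (∀ v, CobordantChart.initEval (fun _ : Fin (m + 1) => 1) (v + u₁) (δ.transform (shear a b (fun j => if j ∈ δ.E then 0 else ψ j)) (fun j => if j = b then 0 else 1) c' a).c ((δ.transform (shear a b (fun j => if j ∈ δ.E then 0 else ψ j)) (fun j => if j = b then 0 else 1) c' a).f * ∏ l ∈ (δ.transform (shear a b (fun j => if j ∈ δ.E then 0 else ψ j)) (fun j => if j = b then 0 else 1) c' a).O, X l) =
          CobordantChart.initEval (fun _ : Fin (m + 1) => 1) v (δ.transform (shear a b (fun j => if j ∈ δ.E then 0 else ψ j)) (fun j => if j = b then 0 else 1) c' a).c ((δ.transform (shear a b (fun j => if j ∈ δ.E then 0 else ψ j)) (fun j => if j = b then 0 else 1) c' a).f * ∏ l ∈ (δ.transform (shear a b (fun j => if j ∈ δ.E then 0 else ψ j)) (fun j => if j = b then 0 else 1) c' a).O, X l)) →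
        (∀ v, CobordantChart.initEval (fun _ : Fin (m + 1) => 1) (v + u₂) (δ.transform (shear a b (fun j => if j ∈ δ.E then 0 else ψ j)) (fun j => if j = b then 0 else 1) c' a).c ((δ.transform (shear a b (fun j => if j ∈ δ.E then 0 else ψ j)) (fun j => if j = b then 0 else 1) c' a).f * ∏ l ∈ (δ.transform (shear a b (fun j => if j ∈ δ.E then 0 else ψ j)) (fun j => if j = b then 0 else 1) c' a).O, X l) =
          CobordantChart.initEval (fun _ : Fin (m + 1) => 1) v (δ.transform (shear a b (fun j => if j ∈ δ.E then 0 else ψ j)) (fun j => if j = b then 0 else 1) c' a).c ((δ.transform (shear a b (fun j => if j ∈ δ.E then 0 else ψ j)) (fun j => if j = b then 0 else 1) c' a).f * ∏ l ∈ (δ.transform (shear a b (fun j => if j ∈ δ.E then 0 else ψ j)) (fun j => if j = b then 0 else 1) c' a).O, X l)) →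
        (∀ v, CobordantChart.initEval (fun _ : Fin (m + 1) => 1) (v + u₃) (δ.transform (shear a b (fun j => if j ∈ δ.E then 0 else ψ j)) (fun j => if j = b then 0 else 1) c' a).c ((δ.transform (shear a b (fun j => if j ∈ δ.E then 0 else ψ j)) (fun j => if j = b then 0 else 1) c' a).f * ∏ l ∈ (δ.transform (shear a b (fun j => if j ∈ δ.E then 0 else ψ j)) (fun j => if j = b then 0 else 1) c' a).O, X l) =
          CobordantChart.initEval (fun _ : Fin (m + 1) => 1) v (δ.transform (shear a b (fun j => if j ∈ δ.E then 0 else ψ j)) (fun j => if j = b then 0 else 1) c' a).c ((δ.transform (shear a b (fun j => if j ∈ δ.E then 0 else ψ j)) (fun j => if j = b then 0 else 1) c' a).f * ∏ l ∈ (δ.transform (shear a b (fun j => if j ∈ δ.E then 0 else ψ j)) (fun j => if j = b then 0 else 1) c' a).O, X l)) →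
        ∃ α β γ : k, (α ≠ 0 ∨ β ≠ 0 ∨ γ ≠ 0) ∧ α • u₁ + β • u₂ + γ • u₃ = 0)) :
    MoveClause b₀ (shear a b (fun j => if j ∈ δ.E then 0 else ψ j)) (fun j => if j = b then 0 else 1)
      (fun b' => ∃ δ' : Decoration k m, Admissible b' δ' ∧ (δ'.head < δ.head ∨ (δ'.head = δ.head ∧ SurfState δ'))) := by
  classical
  set Φ := shear a b (fun j => if j ∈ δ.E then 0 else ψ j) with hΦ
  set w : Fin (m + 1) → ℕ := fun j => if j = b then 0 else 1 with hw
  have hf : δ.f ≠ 0 := hadm.2.1.ne_zero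
  have hpermB : IsBPermissible δ Φ w := isBPermissible_partialShear hadm hab hψ hE hperm
  intro c hc0 hcne A G hfac hG
  have hcb : c b = 0 := hc0 b (by simp [hw])
  have hconv : ∀ l, w l = 0 → c l = 0 := hc0
  have hgen : ∀ s, c s ≠ 0 → Admissible (X 0 * TupleGame.slice s G) (δ.transform Φ w c s) ∧ (δ.transform Φ w c s).head ≤ δ.head :=
    fun s hs => ⟨admissible_transform hadm hpermB hconv hfac hG hs, Decoration.head_transform_le hpermB hconv hf hs⟩
  -- any live slot: if the head dropped there, done
  obtain ⟨s₀, hs₀⟩ : ∃ s, c s ≠ 0 := Function.ne_iff.mp hcne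
  by_cases hlt₀ : (δ.transform Φ w c s₀).head < δ.head
  · exact ⟨s₀, hs₀, _, (hgen s₀ hs₀).1, Or.inl hlt₀⟩
  have hhead₀ : (δ.transform Φ w c s₀).head = δ.head := le_antisymm (hgen s₀ hs₀).2 (not_lt.mp hlt₀)
  -- the answer is the surface direction: live slot `a`
  obtain ⟨H, U, hfacH, hH, -, -⟩ := Decoration.totalO_chart_eq hpermB hconv hf hs₀
  obtain ⟨hc', hca⟩ := curveTangent_answer_of_head_eq hadm hab hψ hE hperm htwo hcb hs₀ hfacH hH hhead₀
  refine ⟨a, hca, _, (hgen a hca).1, ?_⟩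
  by_cases hlt : (δ.transform Φ w c a).head < δ.head
  · exact Or.inl hlt
  have hhead : (δ.transform Φ w c a).head = δ.head := le_antisymm (hgen a hca).2 (not_lt.mp hlt)
  obtain ⟨hcE, -⟩ := curve_answer_apply hc'
  exact Or.inr ⟨hhead, ⟨Fin.predAbove a b.succ, 0, curveStep a ψ δ.E c, predAbove_succ_ne_zero' hab,
    constantCoeff_curveStep_of_ne (b := b) hcE, inOffPlaneIdeal_curveTransform hadm hab hψ hE hperm hc' hca hcb hhead⟩,
    hpers c hca hcb hhead _ (hgen a hca).1⟩

end GraphSurf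

end TameFourTupleDrop

end Summit.ResolutionOfSingularities.ResolutionOfSingularities.Theorems

end
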